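import Literature.Computability.Complexity.GateEliminationCases5to8Split
import Literature.Computability.Complexity.GateEliminationWiresUntouched

/-!
# Gate elimination: two constant substitutions trivializing two ∧-gates (Cases 5.2, 5.4 of Li–Yang)

The alternative strategy used in Case 5.2 ("we substitute appropriate constant to `z` and `y` so
that both `E` and `G` are trivialized, then eliminate `B` by Rule 1. These two substitutions kill
three influential inputs `x`, `y` and `z`, hence `Δμ ≥ 3α_I/2 ≥ δ` per substitution"), in
Case 5.4.2 ("If `B` is a `1`-gate, we substitute constant values to `z` and `y` to trivialize both
`E` and `G`. This will make `B` a `0`-gate, so can be further removed by Rule 1") and similar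
leaves of §4.1 (ECCC TR21-023): PROVED as `stepGoal_two_consts` from a generic two-substitution
accounting `stepGoal_of_t2`, and the lemma `out_ne_of_read_bYacyclic` (a gate read by a gate of
the acyclic part is not the output, by reachability of the output).

## References

* J. Li, T. Yang, *3.1n − o(n) circuit lower bounds for explicit functions*, STOC 2022;
  ECCC TR21-023, §4.1 (Cases 5.2, 5.4.2), Lemma 3.11.
-/

namespace Literature.Computability.Complexity

open Finset

namespace Semicircuit

variable {n : ℕ} {C : Semicircuit n} {f : (Fin n → ZMod 2) → Bool} {R : RdqSource n} {d : ℕ}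
  {αφ αI αQ : ℝ}

/-- **A gate read by a gate of the acyclic part is not the output** (the reader reaches the
output along wires; the gates met are acyclic of increasing rank, so the output cannot feed the
reader). [cite: LiYang2022, §2.5, §3.3 (Rule 1)] -/
theorem out_ne_of_read_bYacyclic (hS : C.Standing R) {E B : Fin C.m} (hE : E ∉ C.xorPart) (hBE : C.Reads B E) :
    C.out ≠ .gate B := by
  intro hout
  obtain ⟨k, hk, hreach⟩ := hS.reachesOut E hE
  rw [hout] at hk; cases hk
  obtain ⟨ρ, hρ⟩ := C.acyclic
  -- along the reachability chain from `E`: outside the xor-part, of rank `≥ rank E`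
  have key : ∀ k, Relation.ReflTransGen C.Reads E k → k ∉ C.xorPart ∧ ρ E ≤ ρ k := by
    intro k h
    induction h with
    | refl => exact ⟨hE, le_rfl⟩
    | tail _ hlast ih =>
      obtain ⟨a, ha⟩ := hlast
      have hcK : _ ∉ C.xorPart := fun hcK => ih.1 (C.mem_of_arg_eq _ hcK a _ ha)
      exact ⟨hcK, ih.2.trans (hρ _ hcK a _ ha ih.1).le⟩
  obtain ⟨hBK, hle⟩ := key B hreach
  obtain ⟨a, ha⟩ := hBE
  have := hρ E hE a B ha hBK
  omega

/-- **Two constant substitutions** (generic accounting): after `x_y := c_y` and `x_z := c_z` to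
distinct unprotected free variables, a fair circuit computing `f` on the new source with
`μ' ≤ μ(C, ∅, R) - g` and `2δ ≤ g` gives the second branch of the one-step claim with `t = 2`.
[cite: LiYang2022, Thm. 4.1 (proof), §4.1] -/
theorem stepGoal_of_t2 {y z : Fin n} (hy : R.Free y) (hyp : ¬ R.Protected y) (cy cz : ZMod 2)
    (hz' : (R.assignFree y cy hy hyp).Free z) (hzp' : ¬ (R.assignFree y cy hy hyp).Protected z)
    {C' : Semicircuit n} {P' : Finset (Fin C'.m × Fin C'.m)} (hF' : C'.Fair)
    (hC' : C'.ComputesRestr f ((R.assignFree y cy hy hyp).assignFree z cz hz' hzp')) (hP' : C'.IsPacking P')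
    (g : ℝ) (hg : 2 * liYangDelta αφ αI αQ ≤ g)
    (hμ : C'.measure αφ αI αQ P' ((R.assignFree y cy hy hyp).assignFree z cz hz' hzp') ≤ C.measure αφ αI αQ ∅ R - g) :
    C.StepGoal f R αφ αI αQ := by
  refine Or.inr ⟨2, by norm_num, by norm_num, C', _, P', hF', hC', hP', ?_, ?_⟩
  · have h1 := RdqSource.dim_assignFree (b := cz) hz' hzp'
    have h2 := RdqSource.dim_assignFree (b := cy) hy hyp
    omega
  · push_cast; linarith

/-- **Trivializing two ∧-gates by two constant substitutions** (Cases 5.2 / 5.4.2 of Li–Yang): the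
∧-type gate `G` reads `y` (at `aY`) and `x`; the ∧-type gate `E ≠ G` reads `z` (at `aZ`) and the
`1`-gate `B`, which reads `x`; `x` is a `2`-variable; `x, y, z` are distinct and unprotected.
Then `y := c_y`, `z := c_z` trivializing `G` and `E`, the eliminations of `G`, `E` and then of the
`0`-gate `B` (Rule 1) make `x, y, z` non-influential: `Δμ ≥ 3α_I + 3 - 4α_φ ≥ 2δ`, `t = 2`.
[cite: LiYang2022, §4.1 (Cases 5.2, 5.4.2)] -/
theorem stepGoal_two_consts (hf : IsAffineDisperser f d) (hd : 2 * d + 2 < R.dim) (hF : C.Fair)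
    (hC : C.ComputesRestr f R) (hS : C.Standing R) (hφ : 0 ≤ αφ) (hφ1 : αφ ≤ 3 / 4) (hI : 0 ≤ αI) (αQ : ℝ)
    {G E B : Fin C.m} {x y z : Fin n} {aY aZ aXB : Fin 2}
    (hGand : IsAndOp (C.op G)) (hGy : C.arg G aY = .var y) (hGx : C.arg G aY.rev = .var x)
    (hEand : IsAndOp (C.op E)) (hEz : C.arg E aZ = .var z) (hEB : C.arg E aZ.rev = .gate B)
    (hBx : C.arg B aXB = .var x) (hB1 : C.fanout (.gate B) = 1) (hx2 : C.fanout (.var x) = 2)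
    (hxy : x ≠ y) (hxz : x ≠ z) (hyz : y ≠ z) (hEG : E ≠ G) (hBG : B ≠ G) :
    C.StepGoal f R αφ αI αQ := by
  classical
  have hN := hS.normalized.1
  have hy : R.Free y := free_of_reads hC hGy
  have hz : R.Free z := free_of_reads hC hEz
  have hyp : ¬ R.Protected y := fun hp => hS.protected_not_and y hp G aY hGy hGand
  have hzp : ¬ R.Protected z := fun hp => hS.protected_not_and z hp E aZ hEz hEand
  have hxp : ¬ R.Protected x := fun hp => hS.protected_not_and x hp G aY.rev hGx hGand
  have hEK : E ∉ C.xorPart := C.not_mem_xorPart_of_isAndOp hEand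
  have hGK : G ∉ C.xorPart := C.not_mem_xorPart_of_isAndOp hGand
  have hBE : B ≠ E := fun h => by rw [h] at hEB; exact C.arg_ne_self_of_not_mem hEK _ hEB
  have hBout : C.out ≠ .gate B := out_ne_of_read_bYacyclic hS hEK ⟨aZ.rev, hEB⟩
  -- the trivializing constants
  obtain ⟨bY, hbY⟩ := exists_trivializing hGand aY
  obtain ⟨bz, hbz⟩ := exists_trivializing hEand aZ
  let cy : ZMod 2 := finTwoEquiv.symm bY
  let cz : ZMod 2 := finTwoEquiv.symm bz
  have hcy : finTwoEquiv cy = bY := finTwoEquiv.apply_symm_apply _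
  have hcz : finTwoEquiv cz = bz := finTwoEquiv.apply_symm_apply _
  -- the two substitutions
  let C₁ := C.substConst y (finTwoEquiv cy)
  let R₁ := R.assignFree y cy hy hyp
  have hF₁ : C₁.Fair := hF.substConst y _
  have hC₁ : C₁.ComputesRestr f R₁ := hC.substConst_assignFree hy hyp cy
  have hz' : R₁.Free z := (RdqSource.free_assignFree_iff hy hyp z).mpr ⟨hz, fun h => hyz h.symm⟩
  have hzp' : ¬ R₁.Protected z := fun h => hzp ((RdqSource.protected_assignFree_iff hy hyp z).mp h)
  let C₂ := C₁.substConst z (finTwoEquiv cz)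
  let R₂ := R₁.assignFree z cz hz' hzp'
  have hF₂ : C₂.Fair := hF₁.substConst z _
  have hC₂ : C₂.ComputesRestr f R₂ := hC₁.substConst_assignFree hz' hzp' cz
  have hd₂ : 2 * d ≤ R₂.dim := by
    have h1 := RdqSource.dim_assignFree (b := cz) hz' hzp'
    have h2 := RdqSource.dim_assignFree (b := cy) hy hyp
    change R₂.dim + 1 = R₁.dim at h1
    change R₁.dim + 1 = R.dim at h2
    omega
  -- wires of `C₂`
  have harg₂ : ∀ k a, C₂.arg k a = ((C.arg k a).substConst y (finTwoEquiv cy)).substConst z (finTwoEquiv cz) := fun k a => rfl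
  have hw_of_ne : ∀ {k a}, C.arg k a ≠ .var y → C.arg k a ≠ .var z → C₂.arg k a = C.arg k a := by
    intro k a h1 h2
    rw [harg₂]
    cases hv : C.arg k a with
    | const c => rfl
    | var i =>
      rw [hv] at h1 h2
      have hiy : i ≠ y := fun h => h1 (by rw [h])
      have hiz : i ≠ z := fun h => h2 (by rw [h])
      rw [Node.substConst_var_of_ne hiy, Node.substConst_var_of_ne hiz]
    | gate g => rfl
  have hGy₂ : C₂.arg G aY = .const bY := by
    rw [harg₂, hGy, Node.substConst_var_self, hcy]; rfl
  have hEz₂ : C₂.arg E aZ = .const bz := by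
    rw [harg₂, hEz, Node.substConst_var_of_ne (fun h => hyz h.symm), Node.substConst_var_self, hcz]
  have hGx₂ : C₂.arg G aY.rev = .var x := by
    rw [hw_of_ne (by rw [hGx]; exact fun h => hxy (Node.var.inj h)) (by rw [hGx]; exact fun h => hxz (Node.var.inj h)), hGx]
  have hEB₂ : C₂.arg E aZ.rev = .gate B := by
    rw [hw_of_ne (by rw [hEB]; exact fun h => by cases h) (by rw [hEB]; exact fun h => by cases h), hEB]
  have hBx₂ : C₂.arg B aXB = .var x := by
    rw [hw_of_ne (by rw [hBx]; exact fun h => hxy (Node.var.inj h)) (by rw [hBx]; exact fun h => hxz (Node.var.inj h)), hBx]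
  have htrivG : C₂.liveFn G aY bY false = C₂.liveFn G aY bY true := hbY
  have htrivE : C₂.liveFn E aZ bz false = C₂.liveFn E aZ bz true := hbz
  have hout₂G : C₂.out ≠ .gate G := out_ne_of_trivialized hf hd₂ hF₂ hC₂ hGy₂ htrivG
  -- step 1: eliminate `G`
  let E₁ := elimDataWTriv hF₂ hC₂ C₂.isPacking_empty hGy₂ htrivG hout₂G hφ hI αQ
  have hrepl₁ : E₁.repl = .const (C₂.liveFn G aY bY false) := rfl
  -- `E` after step 1
  obtain ⟨kE, hkE⟩ := E₁.ι_surj E hEG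
  have hEnotG : ∀ a, C₂.arg (E₁.ι kE) a ≠ .gate G := by
    intro a h
    rw [hkE] at h
    rcases fin2_eq_or_eq_rev aZ a with e | e
    · rw [e, hEz₂] at h; cases h
    · rw [e, hEB₂] at h; cases h; exact hBG rfl
  have hEz' : E₁.C'.arg kE aZ = .const bz := by
    rw [E₁.arg_eq_const_iff, hkE]; exact Or.inl hEz₂
  obtain ⟨-, s, τ, hlive⟩ := E₁.liveFn_eq kE (a := aZ) (b := bz) (by rw [hkE]; exact hEz₂)
  have htrivE' : E₁.C'.liveFn kE aZ bz false = E₁.C'.liveFn kE aZ bz true := by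
    rw [hlive, hlive, hkE]
    cases s
    · rw [Bool.xor_false, Bool.xor_false, htrivE]
    · show (C₂.liveFn E aZ bz (!false) ^^ τ) = (C₂.liveFn E aZ bz (!true) ^^ τ)
      rw [Bool.not_false, Bool.not_true, htrivE]
  have hout₁E : E₁.C'.out ≠ .gate kE := out_ne_of_trivialized hf hd₂ E₁.fair E₁.computes hEz' htrivE'
  -- step 2: eliminate `E`
  let E₂ := elimDataWTriv E₁.fair E₁.computes E₁.packing hEz' htrivE' hout₁E hφ hI αQ
  have hrepl₂ : E₂.repl = .const (E₁.C'.liveFn kE aZ bz false) := rfl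
  -- `B` after steps 1, 2: a `0`-gate, not the output
  obtain ⟨kB₁, hkB₁⟩ := E₁.ι_surj B hBG
  have hkB₁E : kB₁ ≠ kE := fun h => hBE (by rw [← hkB₁, ← hkE, h])
  obtain ⟨kB, hkB⟩ := E₂.ι_surj kB₁ hkB₁E
  have hfanB₁ : E₁.C'.fanout (.gate kB₁) = 1 := by
    rw [E₁.fanout_gate_eq (fun a h => ?_) (by rw [hrepl₁]; exact fun h => by cases h), hkB₁]
    · show (C₁.substConst z (finTwoEquiv cz)).fanout (.gate B) = 1
      rw [C₁.fanout_substConst_gate]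
      show (C.substConst y (finTwoEquiv cy)).fanout (.gate B) = 1
      rw [C.fanout_substConst_gate]; exact hB1
    · rw [hkB₁] at h
      rcases fin2_eq_or_eq_rev aY a with e | e
      · rw [e, hGy₂] at h; cases h
      · rw [e, hGx₂] at h; cases h
  have hEB₁ : E₁.C'.arg kE aZ.rev = .gate kB₁ := by
    rw [E₁.arg_eq_gate_iff, hkE, hkB₁]; exact Or.inl hEB₂
  have hfanB : E₂.C'.fanout (.gate kB) = 0 := by
    have h1 := E₂.fanout_gate_add (k' := kB) (by rw [hrepl₂]; exact fun h => by cases h)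
    rw [hkB, hfanB₁] at h1
    have h2 : 1 ≤ (univ.filter fun a : Fin 2 => E₁.C'.arg kE a = .gate kB₁).card :=
      card_pos.mpr ⟨aZ.rev, mem_filter.mpr ⟨mem_univ _, hEB₁⟩⟩
    omega
  have houtB : E₂.C'.out ≠ .gate kB := by
    intro h
    have h2 := E₂.out_eq
    rw [h, if_neg hout₁E] at h2
    change Node.gate (E₂.ι kB) = E₁.C'.out at h2
    rw [hkB] at h2
    have h1 := E₁.out_eq
    rw [← h2, if_neg hout₂G] at h1
    change Node.gate (E₁.ι kB₁) = C₂.out at h1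
    rw [hkB₁] at h1
    obtain ⟨ko, hko⟩ := exists_out_eq_gate' hf hF hC (by omega)
    have hout₂ : C₂.out = .gate ko := by
      show ((C.out.substConst y (finTwoEquiv cy)).substConst z (finTwoEquiv cz)) = _
      rw [hko]; rfl
    rw [hout₂] at h1
    cases h1
    exact hBout hko
  -- step 3: delete `B`
  have hno : ∀ k a, E₂.C'.arg k a ≠ .gate kB := (fanout_eq_zero_iff _ _).mp hfanB
  let ε := E₂.C'.skipEquiv kB
  let C₃ := E₂.C'.removeGate kB ε
  have hF₃ : C₃.Fair := E₂.fair.removeGate ε hno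
  have hC₃ : C₃.ComputesRestr f R₂ := E₂.computes.removeGate ε E₂.fair hno houtB
  obtain ⟨P₃, hP₃, hpot₃⟩ := E₂.C'.exists_packing_removeGate_le kB ε hno E₂.packing
  have hpot₃' : C₃.potential P₃ ≤ E₂.C'.potential E₂.P' + 2 := hpot₃.trans (by split_ifs <;> norm_num)
  -- `x` is a `0`-variable at the end
  have hx₂ : C₂.fanout (.var x) = 2 := by
    show (C₁.substConst z (finTwoEquiv cz)).fanout (.var x) = 2
    rw [C₁.fanout_substConst_var_of_ne z _ hxz]
    show (C.substConst y (finTwoEquiv cy)).fanout (.var x) = 2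
    rw [C.fanout_substConst_var_of_ne y _ hxy]; exact hx2
  have hx₁' : E₁.C'.fanout (.var x) = 1 := by
    have h1 := E₁.fanout_var_add (i := x) (by rw [hrepl₁]; exact fun h => by cases h)
    have h2 : (univ.filter fun a : Fin 2 => C₂.arg G a = .var x).card = 1 := by
      rw [card_eq_one]; refine ⟨aY.rev, ?_⟩; ext a
      rw [mem_filter, mem_singleton]
      constructor
      · intro h
        rcases fin2_eq_or_eq_rev aY a with e | e
        · have := h.2; rw [e, hGy₂] at this; cases this
        · exact e
      · rintro rfl; exact ⟨mem_univ _, hGx₂⟩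
    omega
  have hx₂' : E₂.C'.fanout (.var x) = 1 := by
    rw [E₂.fanout_var_eq (fun a h => ?_) (by rw [hrepl₂]; exact fun h => by cases h)]
    · exact hx₁'
    · rcases fin2_eq_or_eq_rev aZ a with e | e
      · rw [e, hEz'] at h; cases h
      · rw [e, hEB₁] at h; cases h
  have hkBx : E₂.C'.arg kB aXB = .var x := by
    rw [E₂.arg_eq_var_iff, hkB]; left
    rw [E₁.arg_eq_var_iff, hkB₁]; left
    exact hBx₂
  have hx₃ : C₃.fanout (.var x) = 0 := by
    have h1 := E₂.C'.fanout_removeGate_add kB ε hno (v := .var x) (fun h => by cases h)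
    have h2 : 1 ≤ (univ.filter fun a : Fin 2 => E₂.C'.arg kB a = .var x).card :=
      card_pos.mpr ⟨aXB, mem_filter.mpr ⟨mem_univ _, hkBx⟩⟩
    change C₃.fanout (.var x) + _ = _ at h1
    omega
  -- influential inputs: `x, y, z` are gone
  have hxinf : x ∈ C.influential R := C.mem_influential_of_reads R hGx
  have hyinf : y ∈ C.influential R := C.mem_influential_of_reads R hGy
  have hzinf : z ∈ C.influential R := C.mem_influential_of_reads R hEz
  have hsub₂ : C₂.influential R₂ ⊆ ((C.influential R).erase y).erase z := by
    intro i hi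
    have h1 := C₁.influential_substConst_assignFree_subset hz' hzp' cz (finTwoEquiv cz) hi
    rw [mem_erase] at h1 ⊢
    refine ⟨h1.1, ?_⟩
    exact C.influential_substConst_assignFree_subset hy hyp cy (finTwoEquiv cy) h1.2
  have hsub₃ : C₃.influential R₂ ⊆ (((C.influential R).erase y).erase z).erase x := by
    intro i hi
    have h0 : i ∈ E₂.C'.influential R₂ := E₂.C'.influential_removeGate_subset kB ε hno R₂ hi
    have h1 : i ∈ C₂.influential R₂ := E₁.influential_subset R₂ (E₂.influential_subset R₂ h0)
    rw [mem_erase]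
    refine ⟨?_, hsub₂ h1⟩
    rintro rfl
    unfold influential at hi
    rw [mem_filter] at hi
    rcases hi.2 with h | h
    · rw [hx₃] at h; exact absurd h (by norm_num)
    · have h' := (RdqSource.protected_assignFree_iff hz' hzp' i).mp h
      exact hxp ((RdqSource.protected_assignFree_iff hy hyp i).mp h')
  have hcard : ((C₃.influential R₂).card : ℝ) + 3 ≤ (C.influential R).card := by
    have h1 := card_le_card hsub₃
    have hy' : y ∈ C.influential R := hyinf
    have hz' : z ∈ (C.influential R).erase y := mem_erase.mpr ⟨fun h => hyz h.symm, hzinf⟩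
    have hx' : x ∈ ((C.influential R).erase y).erase z := mem_erase.mpr ⟨hxz, mem_erase.mpr ⟨hxy, hxinf⟩⟩
    have e1 := card_erase_add_one hx'
    have e2 := card_erase_add_one hz'
    have e3 := card_erase_add_one hy'
    have : (C₃.influential R₂).card + 3 ≤ (C.influential R).card := by omega
    exact_mod_cast this
  -- potential
  have hpot : (C₃.potential P₃ : ℝ) ≤ C.potential ∅ + 4 := by
    have h1 : (E₁.C'.potential E₁.P' : ℝ) ≤ C₂.potential ∅ + 1 := E₁.potential_le
    have h2 : (E₂.C'.potential E₂.P' : ℝ) ≤ E₁.C'.potential E₁.P' + 1 := E₂.potential_le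
    have h0 : (C₂.potential ∅ : ℝ) ≤ C.potential ∅ := by
      unfold potential
      simp only [card_empty, Nat.cast_zero, sub_zero]
      have := (troubledCount_substConst_le (C := C₁) (j := z) (b := finTwoEquiv cz)).trans
        (troubledCount_substConst_le (C := C) (j := y) (b := finTwoEquiv cy))
      exact_mod_cast this
    linarith
  -- gates and quadratic equations
  have hm : (C₃.m : ℝ) + 3 = C.m := by
    have h1 : E₁.C'.m + 1 = C.m := E₁.m_add_one
    have h2 : E₂.C'.m + 1 = E₁.C'.m := E₂.m_add_one
    have h3 := E₂.C'.removeGate_m_add_one kB ε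
    have : C₃.m + 3 = C.m := by change (E₂.C'.m - 1) + 3 = C.m; omega
    exact_mod_cast this
  have hq : (R₂.quadCount : ℝ) = R.quadCount := by
    show (((R.assignFree y cy hy hyp).assignFree z cz hz' hzp').quadCount : ℝ) = _
    rw [RdqSource.quadCount_assignFree, RdqSource.quadCount_assignFree]
  -- assemble
  refine stepGoal_of_t2 hy hyp cy cz hz' hzp' hF₃ hC₃ hP₃ (3 * αI + (3 - 4 * αφ)) ?_ ?_
  · have := liYangDelta_le_four_thirds αφ αI αQ; nlinarith
  · unfold measure
    rw [hq]
    nlinarith [mul_le_mul_of_nonneg_left hcard hI, mul_le_mul_of_nonneg_left hpot hφ]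

/-- **Trivializing the two readers of `x` by two constant substitutions** (Case 5.4.1.1.2 of
Li–Yang: "If `B` is an ∧-type gate, then we can substitute constant values to `t` and `y` to
trivialize `B` and `G`, making `x` a `0`-variable. Hence `Δμ ≥ 3α_I/2 ≥ δ`" per substitution):
the ∧-type gate `G` reads `y` (at `aY`) and `x`, the ∧-type gate `B ≠ G` reads `t` (at `aT`) and
`x`, `x` is a `2`-variable, `x, y, t` distinct and unprotected. Then `y := c_y`, `t := c_t`
trivializing `G` and `B` and their eliminations make `x, y, t` non-influential:
`Δμ ≥ 3α_I + 2 - 2α_φ ≥ 2δ`, `t = 2`. [cite: LiYang2022, §4.1 (Case 5.4.1.1.2)] -/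
theorem stepGoal_two_consts_readers (hf : IsAffineDisperser f d) (hd : 2 * d + 2 < R.dim) (hF : C.Fair)
    (hC : C.ComputesRestr f R) (hS : C.Standing R) (hφ : 0 ≤ αφ) (hφ1 : αφ ≤ 1) (hI : 0 ≤ αI) (αQ : ℝ)
    {G B : Fin C.m} {x y t : Fin n} {aY aT : Fin 2}
    (hGand : IsAndOp (C.op G)) (hGy : C.arg G aY = .var y) (hGx : C.arg G aY.rev = .var x)
    (hBand : IsAndOp (C.op B)) (hBt : C.arg B aT = .var t) (hBx : C.arg B aT.rev = .var x)
    (hx2 : C.fanout (.var x) = 2) (hxy : x ≠ y) (hxt : x ≠ t) (hyt : y ≠ t) (hBG : B ≠ G) :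
    C.StepGoal f R αφ αI αQ := by
  classical
  have hy : R.Free y := free_of_reads hC hGy
  have ht : R.Free t := free_of_reads hC hBt
  have hyp : ¬ R.Protected y := fun hp => hS.protected_not_and y hp G aY hGy hGand
  have htp : ¬ R.Protected t := fun hp => hS.protected_not_and t hp B aT hBt hBand
  have hxp : ¬ R.Protected x := fun hp => hS.protected_not_and x hp G aY.rev hGx hGand
  -- the trivializing constants
  obtain ⟨bY, hbY⟩ := exists_trivializing hGand aY
  obtain ⟨bT, hbT⟩ := exists_trivializing hBand aT
  let cy : ZMod 2 := finTwoEquiv.symm bY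
  let ct : ZMod 2 := finTwoEquiv.symm bT
  have hcy : finTwoEquiv cy = bY := finTwoEquiv.apply_symm_apply _
  have hct : finTwoEquiv ct = bT := finTwoEquiv.apply_symm_apply _
  -- the two substitutions
  let C₁ := C.substConst y (finTwoEquiv cy)
  let R₁ := R.assignFree y cy hy hyp
  have hF₁ : C₁.Fair := hF.substConst y _
  have hC₁ : C₁.ComputesRestr f R₁ := hC.substConst_assignFree hy hyp cy
  have ht' : R₁.Free t := (RdqSource.free_assignFree_iff hy hyp t).mpr ⟨ht, fun h => hyt h.symm⟩
  have htp' : ¬ R₁.Protected t := fun h => htp ((RdqSource.protected_assignFree_iff hy hyp t).mp h)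
  let C₂ := C₁.substConst t (finTwoEquiv ct)
  let R₂ := R₁.assignFree t ct ht' htp'
  have hF₂ : C₂.Fair := hF₁.substConst t _
  have hC₂ : C₂.ComputesRestr f R₂ := hC₁.substConst_assignFree ht' htp' ct
  have hd₂ : 2 * d ≤ R₂.dim := by
    have h1 := RdqSource.dim_assignFree (b := ct) ht' htp'
    have h2 := RdqSource.dim_assignFree (b := cy) hy hyp
    change R₂.dim + 1 = R₁.dim at h1
    change R₁.dim + 1 = R.dim at h2
    omega
  -- wires of `C₂`
  have harg₂ : ∀ k a, C₂.arg k a = ((C.arg k a).substConst y (finTwoEquiv cy)).substConst t (finTwoEquiv ct) := fun k a => rfl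
  have hw_of_ne : ∀ {k a}, C.arg k a ≠ .var y → C.arg k a ≠ .var t → C₂.arg k a = C.arg k a := by
    intro k a h1 h2
    rw [harg₂]
    cases hv : C.arg k a with
    | const c => rfl
    | var i =>
      rw [hv] at h1 h2
      have hiy : i ≠ y := fun h => h1 (by rw [h])
      have hit : i ≠ t := fun h => h2 (by rw [h])
      rw [Node.substConst_var_of_ne hiy, Node.substConst_var_of_ne hit]
    | gate g => rfl
  have hGy₂ : C₂.arg G aY = .const bY := by
    rw [harg₂, hGy, Node.substConst_var_self, hcy]; rfl
  have hBt₂ : C₂.arg B aT = .const bT := by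
    rw [harg₂, hBt, Node.substConst_var_of_ne (fun h => hyt h.symm), Node.substConst_var_self, hct]
  have hGx₂ : C₂.arg G aY.rev = .var x := by
    rw [hw_of_ne (by rw [hGx]; exact fun h => hxy (Node.var.inj h)) (by rw [hGx]; exact fun h => hxt (Node.var.inj h)), hGx]
  have hBx₂ : C₂.arg B aT.rev = .var x := by
    rw [hw_of_ne (by rw [hBx]; exact fun h => hxy (Node.var.inj h)) (by rw [hBx]; exact fun h => hxt (Node.var.inj h)), hBx]
  have htrivG : C₂.liveFn G aY bY false = C₂.liveFn G aY bY true := hbY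
  have htrivB : C₂.liveFn B aT bT false = C₂.liveFn B aT bT true := hbT
  have hout₂G : C₂.out ≠ .gate G := out_ne_of_trivialized hf hd₂ hF₂ hC₂ hGy₂ htrivG
  -- step 1: eliminate `G`
  let E₁ := elimDataWTriv hF₂ hC₂ C₂.isPacking_empty hGy₂ htrivG hout₂G hφ hI αQ
  have hrepl₁ : E₁.repl = .const (C₂.liveFn G aY bY false) := rfl
  -- `B` after step 1
  obtain ⟨kB, hkB⟩ := E₁.ι_surj B hBG
  have hBnotG : ∀ a, C₂.arg (E₁.ι kB) a ≠ .gate G := by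
    intro a h
    rw [hkB] at h
    rcases fin2_eq_or_eq_rev aT a with e | e
    · rw [e, hBt₂] at h; cases h
    · rw [e, hBx₂] at h; cases h
  have hBt' : E₁.C'.arg kB aT = .const bT := by
    rw [E₁.arg_eq_const_iff, hkB]; exact Or.inl hBt₂
  obtain ⟨-, s, τ, hlive⟩ := E₁.liveFn_eq kB (a := aT) (b := bT) (by rw [hkB]; exact hBt₂)
  have htrivB' : E₁.C'.liveFn kB aT bT false = E₁.C'.liveFn kB aT bT true := by
    rw [hlive, hlive, hkB]
    cases s
    · rw [Bool.xor_false, Bool.xor_false, htrivB]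
    · show (C₂.liveFn B aT bT (!false) ^^ τ) = (C₂.liveFn B aT bT (!true) ^^ τ)
      rw [Bool.not_false, Bool.not_true, htrivB]
  have hout₁B : E₁.C'.out ≠ .gate kB := out_ne_of_trivialized hf hd₂ E₁.fair E₁.computes hBt' htrivB'
  -- step 2: eliminate `B`
  let E₂ := elimDataWTriv E₁.fair E₁.computes E₁.packing hBt' htrivB' hout₁B hφ hI αQ
  have hrepl₂ : E₂.repl = .const (E₁.C'.liveFn kB aT bT false) := rfl
  -- `x` is a `0`-variable at the end
  have hx₂ : C₂.fanout (.var x) = 2 := by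
    show (C₁.substConst t (finTwoEquiv ct)).fanout (.var x) = 2
    rw [C₁.fanout_substConst_var_of_ne t _ hxt]
    show (C.substConst y (finTwoEquiv cy)).fanout (.var x) = 2
    rw [C.fanout_substConst_var_of_ne y _ hxy]; exact hx2
  have hx₁' : E₁.C'.fanout (.var x) = 1 := by
    have h1 := E₁.fanout_var_add (i := x) (by rw [hrepl₁]; exact fun h => by cases h)
    have h2 : (univ.filter fun a : Fin 2 => C₂.arg G a = .var x).card = 1 := by
      rw [card_eq_one]; refine ⟨aY.rev, ?_⟩; ext a
      rw [mem_filter, mem_singleton]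
      constructor
      · intro h
        rcases fin2_eq_or_eq_rev aY a with e | e
        · have := h.2; rw [e, hGy₂] at this; cases this
        · exact e
      · rintro rfl; exact ⟨mem_univ _, hGx₂⟩
    omega
  have hkBx : E₁.C'.arg kB aT.rev = .var x := by
    rw [E₁.arg_eq_var_iff, hkB]; exact Or.inl hBx₂
  have hx₂' : E₂.C'.fanout (.var x) = 0 := by
    have h1 := E₂.fanout_var_add (i := x) (by rw [hrepl₂]; exact fun h => by cases h)
    have h2 : 1 ≤ (univ.filter fun a : Fin 2 => E₁.C'.arg kB a = .var x).card :=
      card_pos.mpr ⟨aT.rev, mem_filter.mpr ⟨mem_univ _, hkBx⟩⟩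
    omega
  -- influential inputs: `x, y, t` are gone
  have hxinf : x ∈ C.influential R := C.mem_influential_of_reads R hGx
  have hyinf : y ∈ C.influential R := C.mem_influential_of_reads R hGy
  have htinf : t ∈ C.influential R := C.mem_influential_of_reads R hBt
  have hsub₂ : C₂.influential R₂ ⊆ ((C.influential R).erase y).erase t := by
    intro i hi
    have h1 := C₁.influential_substConst_assignFree_subset ht' htp' ct (finTwoEquiv ct) hi
    rw [mem_erase] at h1 ⊢
    refine ⟨h1.1, ?_⟩
    exact C.influential_substConst_assignFree_subset hy hyp cy (finTwoEquiv cy) h1.2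
  have hsub₃ : E₂.C'.influential R₂ ⊆ (((C.influential R).erase y).erase t).erase x := by
    intro i hi
    have h1 : i ∈ C₂.influential R₂ := E₁.influential_subset R₂ (E₂.influential_subset R₂ hi)
    rw [mem_erase]
    refine ⟨?_, hsub₂ h1⟩
    rintro rfl
    unfold influential at hi
    rw [mem_filter] at hi
    rcases hi.2 with h | h
    · rw [hx₂'] at h; exact absurd h (by norm_num)
    · have h' := (RdqSource.protected_assignFree_iff ht' htp' i).mp h
      exact hxp ((RdqSource.protected_assignFree_iff hy hyp i).mp h')
  have hcard : ((E₂.C'.influential R₂).card : ℝ) + 3 ≤ (C.influential R).card := by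
    have h1 := card_le_card hsub₃
    have hy' : y ∈ C.influential R := hyinf
    have ht'' : t ∈ (C.influential R).erase y := mem_erase.mpr ⟨fun h => hyt h.symm, htinf⟩
    have hx' : x ∈ ((C.influential R).erase y).erase t := mem_erase.mpr ⟨hxt, mem_erase.mpr ⟨hxy, hxinf⟩⟩
    have e1 := card_erase_add_one hx'
    have e2 := card_erase_add_one ht''
    have e3 := card_erase_add_one hy'
    have : (E₂.C'.influential R₂).card + 3 ≤ (C.influential R).card := by omega
    exact_mod_cast this
  -- potential
  have hpot : (E₂.C'.potential E₂.P' : ℝ) ≤ C.potential ∅ + 2 := by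
    have h1 : (E₁.C'.potential E₁.P' : ℝ) ≤ C₂.potential ∅ + 1 := E₁.potential_le
    have h2 : (E₂.C'.potential E₂.P' : ℝ) ≤ E₁.C'.potential E₁.P' + 1 := E₂.potential_le
    have h0 : (C₂.potential ∅ : ℝ) ≤ C.potential ∅ := by
      unfold potential
      simp only [card_empty, Nat.cast_zero, sub_zero]
      have := (troubledCount_substConst_le (C := C₁) (j := t) (b := finTwoEquiv ct)).trans
        (troubledCount_substConst_le (C := C) (j := y) (b := finTwoEquiv cy))
      exact_mod_cast this
    linarith
  -- gates and quadratic equations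
  have hm : (E₂.C'.m : ℝ) + 2 = C.m := by
    have h1 : E₁.C'.m + 1 = C.m := E₁.m_add_one
    have h2 : E₂.C'.m + 1 = E₁.C'.m := E₂.m_add_one
    have : E₂.C'.m + 2 = C.m := by omega
    exact_mod_cast this
  have hq : (R₂.quadCount : ℝ) = R.quadCount := by
    show (((R.assignFree y cy hy hyp).assignFree t ct ht' htp').quadCount : ℝ) = _
    rw [RdqSource.quadCount_assignFree, RdqSource.quadCount_assignFree]
  -- assemble
  refine stepGoal_of_t2 hy hyp cy ct ht' htp' E₂.fair E₂.computes E₂.packing (3 * αI + (2 - 2 * αφ)) ?_ ?_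
  · have := liYangDelta_le_four_thirds αφ αI αQ; nlinarith
  · unfold measure
    rw [hq]
    nlinarith [mul_le_mul_of_nonneg_left hcard hI, mul_le_mul_of_nonneg_left hpot hφ]

end Semicircuit

end Literature.Computability.Complexity
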